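import Summits.AnomalousDissipation.AnomalousDissipation.Theorems.BaireTransferRobustLoudUpgradeStubCensusInterior
import Summits.AnomalousDissipation.AnomalousDissipation.Theorems.KolmogorovFloorEnsembleCeiling.Negative.Planar

/-!
# Stub `stub_steadyStratumClosed` of the line `malkin-cone-group-orbits`
# (crux stmt-AnomalousDissipation-1144, category package of lead c15):
# each viscosity stratum of the mean-zero steady-loud set is closed

For `0 < ν₁` the coefficient vectors `c ∈ P_S` carrying a MEAN-ZERO classical steady state of
`NS_ν(f_c)` at some viscosity `ν ∈ [ν₁, ν₂]` with budgets `meanEnergy ≤ E`, `meanDissipation ≥ ε`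
form a CLOSED subset of `P_S`.  Proof (compactness with VARYING viscosity in the compact slab,
mirroring `stub_censusInterior` of `…StubCensusInterior`): along `c_n → c` the classical
witnesses `(ν_n, u_n, p_n)` are steady weak solutions `U_n ∈ V` (classical ⇒ weak,
`KolmogorovFloorEnsembleCeiling.Negative.exists_steadyState_of_classical`) with
`meanEnergy = ‖U_n‖²`, `meanDissipation = (U_n, f_{c_n})` (energy equation); the a priori bound
`‖∇U_n‖ ≤ ‖f_{c_n}‖₂/ν_n ≤ M/ν₁` and Rellich (`isCompact_setOf_eGradNormSq_le`) give a
subsequence `U_n → U` in `H`, `ν_n → ν ∈ [ν₁, ν₂]`; the tested generator is affine in `ν` and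
continuous in `(U, f)`, so `U` is a steady weak solution of `NS_ν(f_c)` in `V`, whose classical
mean-zero representative (`exists_isSteadyNSState`) has the limiting budgets `‖U‖² ≤ E`,
`(U, f_c) ≥ ε`.
-/

-- `Summit.<Summit>.<Problem>` is the tree's mandated summit-side namespace (CONVENTIONS §2); for this
-- single-conjunct summit the two coincide, so the duplicate is deliberate.
set_option linter.dupNamespace false

noncomputable section

open scoped BigOperators Topology InnerProductSpace RealInnerProductSpace ENNReal
open Filter Set Function TopologicalSpace MeasureTheory

namespace Summit.AnomalousDissipation.AnomalousDissipation.Theorems.RobustLoudUpgrade.Category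

open Literature.Analysis.FunctionSpaces Literature.Analysis.FunctionSpaces.Torus
open Literature.Analysis.FluidPDE Literature.Analysis.FluidPDE.Torus
open Summit.AnomalousDissipation.AnomalousDissipation.Theses.BaireTransfer
open Summit.AnomalousDissipation.AnomalousDissipation.Theorems.DenseLoudDesignerForces
open Summit.AnomalousDissipation.AnomalousDissipation.Theorems.RobustLoudUpgrade.CensusInterior

/-! ## §1 Classical mean-zero steady states are steady weak solutions in `V`, same budgets -/

/-- **Dictionary classical → weak** on `T³`: a mean-zero classical steady state `(u, p)` of
`NS_ν(f)` (`f` smooth) is (a.e.) a steady weak solution `U ∈ V`, with `meanEnergy = ‖U‖²_{L²}` and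
`meanDissipation = ν‖∇u‖² = (U, f)` (the steady residual `νΔu − (u·∇)u + f = ∇p` is
`L²`-orthogonal to smooth solenoidal fields; energy equation `IsSteadyWeakSolution.energy_eq'`).
[folklore] -/
theorem exists_weak_of_isSteadyNSState {ν : ℝ}
    {f u : UnitAddTorus (Fin 3) → EuclideanSpace ℝ (Fin 3)} {p : UnitAddTorus (Fin 3) → ℝ}
    (hf : IsSmooth f) (hst : Torus.IsSteadyNSState ν f u p) (h0 : HasZeroMean u) :
    ∃ U : energySpace (Fin 3), U.1 ∈ energySpaceV (Fin 3) ∧ IsSteadyWeakSolution ν f U ∧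
      meanEnergy (fun _ : ℝ => u) = ‖U‖ ^ 2 ∧
        meanDissipation ν (fun _ : ℝ => u) = pairing U.1 f := by
  have hu : IsSmooth u := hst.smooth_velocity.isSmooth_slice (mem_univ 0)
  have hp : IsSmooth p := hst.smooth_pressure.isSmooth_slice (mem_univ 0)
  have hdiv : IsDivFree u := hst.divFree 0 (mem_univ 0)
  have hmom : ∀ y, ν • laplacian u y - convect u u y + f y = Torus.gradient p y := fun y => by
    have h := hst.momentum 0 (mem_univ 0) y
    have h0 : Torus.timeDerivWithin Set.univ (fun _ : ℝ => u) 0 y = 0 := by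
      simp [Torus.timeDerivWithin]
    rw [h0, zero_add] at h
    rw [h]
    abel
  have htest : ∀ w : UnitAddTorus (Fin 3) → EuclideanSpace ℝ (Fin 3), IsSmooth w → IsDivFree w →
      HasZeroMean w → ∫ y, ⟪ν • Torus.laplacian u y - Torus.convect u u y + f y, w y⟫_ℝ = 0 :=
    fun w hw hwd _ => by
      simp_rw [hmom]
      exact integral_inner_gradient_eq_zero_of_isDivFree hw hp hwd
  obtain ⟨U, hae, hV, hw⟩ :=
    KolmogorovFloorEnsembleCeiling.Negative.exists_steadyState_of_classical hf hu hdiv h0 htest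
  refine ⟨U, hV, hw, ?_, ?_⟩
  · rw [meanEnergy_eq_of_periodic (τ := 1) (fun _ => rfl) one_pos]
    have h1 : ∫ y, ‖u y‖ ^ 2 = ‖U‖ ^ 2 := by
      rw [Submodule.coe_norm, ← integral_norm_sq_coe_eq]
      exact integral_congr_ae (by filter_upwards [hae] with y hy; rw [hy])
    simp [h1]
  · rw [meanDissipation_eq_of_periodic (τ := 1) (fun _ => rfl) one_pos]
    have h1 : ν * (eGradNormSq u).toReal = pairing U.1 f := by
      rw [← eGradNormSq_congr_ae_field hae]
      exact IsSteadyWeakSolution.energy_eq' (by simp) (hf.memLp 2) hV hw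
    simp [h1]

/-! ## §2 The stub -/

/-- **stub_steadyStratumClosed** (registered sub-goal of lead c15's category package).  For
`0 < ν₁` the coefficient vectors carrying a MEAN-ZERO classical steady state of `NS_ν(f_c)` at some
viscosity `ν ∈ [ν₁, ν₂]` with budgets `meanEnergy ≤ E`, `meanDissipation ≥ ε` form a CLOSED subset
of `P_S`.  (Compactness: classical ⇒ steady weak solution in `V`; uniform enstrophy bound
`‖∇u‖ ≤ ‖f‖₂/ν₁`; Rellich; the weak formulation, affine in `ν`, passes to the limit along
`ν_n → ν`; the limit's classical representative has the limiting budgets.) [folklore] -/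
theorem stub_steadyStratumClosed : ∀ (S : Finset (Fin 3 → ℤ)) (ν₁ ν₂ E ε : ℝ), 0 < ν₁ →
    IsClosed {c : Coeff S | ∃ ν : ℝ, ν₁ ≤ ν ∧ ν ≤ ν₂ ∧
      ∃ (u : UnitAddTorus (Fin 3) → EuclideanSpace ℝ (Fin 3)) (p : UnitAddTorus (Fin 3) → ℝ),
        Torus.IsSteadyNSState ν (force S c) u p ∧ HasZeroMean u ∧
          meanEnergy (fun _ : ℝ => u) ≤ E ∧ ε ≤ meanDissipation ν (fun _ : ℝ => u)} := by
  intro S ν₁ ν₂ E ε hν₁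
  refine isClosed_of_closure_subset fun c hc => ?_
  obtain ⟨x, hxl, hxc⟩ := mem_closure_iff_seq_limit.1 hc
  choose nu hnu1 hnu2 u p hst h0 hE hD using hxl
  have hnu0 : ∀ n, 0 < nu n := fun n => hν₁.trans_le (hnu1 n)
  -- the given classical witnesses as steady weak solutions in `V`, with their budgets
  choose U hUV hUw hUE hUD using fun n =>
    exists_weak_of_isSteadyNSState (isSmooth_force (x n)) (hst n) (h0 n)
  -- the forces in `L²`, uniformly bounded along the sequence
  set F := fun c' : Coeff S => (memLp_force c').toLp (force S c')
  have hFx : Tendsto (fun n => F (x n)) atTop (𝓝 (F c)) :=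
    ((continuous_toLp_force S).tendsto c).comp hxc
  obtain ⟨M, hM⟩ := ((continuous_norm.tendsto _).comp hFx).bddAbove_range
  have hM' : ∀ n, ‖F (x n)‖ ≤ M := fun n => hM ⟨n, rfl⟩
  have hM0 : 0 ≤ M := (norm_nonneg _).trans (hM' 0)
  -- a fixed compact enstrophy ball of `H` containing every `U n` (viscosities `≥ ν₁`)
  set K : Set (energySpace (Fin 3)) := {w | eGradNormSq
    (w.1 : UnitAddTorus (Fin 3) → EuclideanSpace ℝ (Fin 3)) ≤ ENNReal.ofReal ((M / ν₁) ^ 2)}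
  have hKc : IsCompact K := isCompact_setOf_eGradNormSq_le ENNReal.ofReal_ne_top
  have hUK : ∀ n, U n ∈ K := fun n => by
    refine (eGradNormSq_le_of_isSteadyWeakSolution (memLp_force (x n)) (hnu0 n) (hUV n)
      (hUw n)).trans (ENNReal.ofReal_le_ofReal
        (pow_le_pow_left₀ (div_nonneg (norm_nonneg _) (hnu0 n).le) ?_ 2))
    rw [div_le_div_iff₀ (hnu0 n) hν₁]
    exact mul_le_mul (hM' n) (hnu1 n) hν₁.le hM0
  -- subsequence: `U (φ n) → Ul` in `H` and `nu (φ n) → ν ∈ [ν₁, ν₂]`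
  obtain ⟨⟨Ul, ν⟩, ⟨hUlK, hνI⟩, φ, hφ, hlim⟩ :=
    (hKc.prod (isCompact_Icc : IsCompact (Icc ν₁ ν₂))).tendsto_subseq (x := fun n => (U n, nu n))
      fun n => Set.mk_mem_prod (hUK n) ⟨hnu1 n, hnu2 n⟩
  have hlimU : Tendsto (fun n => U (φ n)) atTop (𝓝 Ul) := (continuous_fst.tendsto _).comp hlim
  have hlimν : Tendsto (fun n => nu (φ n)) atTop (𝓝 ν) := (continuous_snd.tendsto _).comp hlim
  have hUlV : Ul.1 ∈ energySpaceV (Fin 3) := ⟨Ul.2, memSobolev_one_complexify_of_eGradNormSq_ne_top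
    (Lp.memLp _) (ne_top_of_le_ne_top ENNReal.ofReal_ne_top hUlK)⟩
  -- the limit is a steady weak solution of `NS_ν(f_c)` (the tested generator is affine in `ν`)
  have hUlw : IsSteadyWeakSolution ν (force S c) Ul := by
    intro w hw hwd hwm
    -- `P W = (W, Δw)` on representatives
    set P : energySpace (Fin 3) → ℝ := fun W =>
      ∫ y, ⟪(W.1 : UnitAddTorus (Fin 3) → EuclideanSpace ℝ (Fin 3)) y, laplacian w y⟫_ℝ with hPdef
    have hA : Tendsto (fun n => nsGeneratorPairing ν (force S c) (U (φ n)) w) atTop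
        (𝓝 (nsGeneratorPairing ν (force S c) Ul w)) :=
      ((continuous_nsGeneratorPairing ν (force S c) hw).tendsto Ul).comp hlimU
    have hB : ∀ m, nsGeneratorPairing ν (force S c) (U m) w =
        ((∫ y, ⟪force S c y, w y⟫_ℝ) - ∫ y, ⟪force S (x m) y, w y⟫_ℝ) +
          (ν - nu m) * P (U m) := fun m => by
      have h := hUw m w hw hwd hwm
      unfold nsGeneratorPairing at h ⊢
      rw [hPdef]
      linear_combination h
    have hPc : Continuous fun c' : Coeff S => ∫ y, ⟪force S c' y, w y⟫_ℝ :=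
      Negative.continuous_pairing S hw.continuous
    have hC₁ : Tendsto (fun n => (∫ y, ⟪force S c y, w y⟫_ℝ) - ∫ y, ⟪force S (x (φ n)) y, w y⟫_ℝ)
        atTop (𝓝 0) := by
      have h : Tendsto (fun n => (∫ y, ⟪force S c y, w y⟫_ℝ) - ∫ y, ⟪force S (x (φ n)) y, w y⟫_ℝ)
          atTop (𝓝 ((∫ y, ⟪force S c y, w y⟫_ℝ) - ∫ y, ⟪force S c y, w y⟫_ℝ)) :=
        tendsto_const_nhds.sub ((hPc.tendsto c).comp (hxc.comp hφ.tendsto_atTop))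
      rw [sub_self] at h
      exact h
    have hP : Tendsto (fun n => P (U (φ n))) atTop (𝓝 (pairing Ul.1 (laplacian w))) :=
      ((continuous_pairing_coe (hw.laplacian.memLp 2)).tendsto Ul).comp hlimU
    have hC₂ : Tendsto (fun n => (ν - nu (φ n)) * P (U (φ n))) atTop (𝓝 0) := by
      have h : Tendsto (fun n => (ν - nu (φ n)) * P (U (φ n))) atTop
          (𝓝 ((ν - ν) * pairing Ul.1 (laplacian w))) :=
        (tendsto_const_nhds.sub hlimν).mul hP
      rw [sub_self, zero_mul] at h
      exact h
    have hC := hC₁.add hC₂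
    rw [add_zero] at hC
    exact tendsto_nhds_unique hA (hC.congr fun n => (hB (φ n)).symm)
  -- its classical mean-zero representative carries the limiting budgets
  have hν : 0 < ν := hν₁.trans_le hνI.1
  obtain ⟨v, q, hvst, hv0, hvE, hvD⟩ :=
    exists_isSteadyNSState (isSmooth_force c) (hasZeroMean_force c) hν hUlV hUlw
  refine ⟨ν, hνI.1, hνI.2, v, q, hvst, hv0, ?_, ?_⟩
  · rw [hvE]
    have h1 : Tendsto (fun n => ‖U (φ n)‖ ^ 2) atTop (𝓝 (‖Ul‖ ^ 2)) :=
      ((continuous_norm.tendsto Ul).comp hlimU).pow 2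
    refine le_of_tendsto' h1 fun n => ?_
    rw [← hUE (φ n)]
    exact hE (φ n)
  · rw [hvD, pairing_eq_inner (memLp_force c)]
    have h2 : Tendsto (fun n => ⟪(U (φ n)).1, F (x (φ n))⟫_ℝ) atTop (𝓝 ⟪Ul.1, F c⟫_ℝ) :=
      ((continuous_subtype_val.tendsto Ul).comp hlimU).inner (hFx.comp hφ.tendsto_atTop)
    refine ge_of_tendsto' h2 fun n => ?_
    have h := hD (φ n)
    rw [hUD (φ n), pairing_eq_inner (memLp_force (x (φ n)))] at h
    exact h

end Summit.AnomalousDissipation.AnomalousDissipation.Theorems.RobustLoudUpgrade.Category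

end
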